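import Literature.Computability.AlgebraicComplexity.BurgisserBooleanPartsA3Steps
import HarnessLib

/-!
# The integer skeleton of a circuit commutes with renaming the input variables

Theorem-only plumbing (no definitions, no named facts) for Bürgisser's integer skeleton of an
arithmetic circuit (`skeleton`, Bürgisser 2000 TCS §5 (A3): every constant of the circuit is
replaced by a slot indeterminate `Y_j`): renaming the INPUT variables of a circuit along
`e : σ → τ` (the tree's `ArithCircuit.rename`) and then taking the skeleton gives the skeleton
renamed along `Sum.map e (Fin.cast _)` (the slot indeterminates are unchanged; the cast only
records `(P.rename e).size = P.size`) — `skeleton_rename`; consequently the polynomial computed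
by the skeleton is renamed accordingly (`eval_skeleton_rename`). Also the naturality of
Mathlib's `sumAlgEquiv` under `rename (Sum.map e f)` on coefficients
(`coeff_mapDomain_sumAlgEquiv_rename`), which is what transports the coefficient ideals of
Bürgisser's "Galois tameness" statements (cell route `LangWeilTransfer`, items `UniversalTameness`,
`ShatteringExclusion`) between variable types. Consumer:
`Summits/ValiantsHypothesis/ValiantsHypothesis/Theorems/LangWeilTransferUniversalGlue.lean`.
Honest framing: bookkeeping; nothing here bears on VP versus VNP.

## References

* [Burgisser2000TCS] P. Bürgisser, *Cook's versus Valiant's hypothesis*, Theoret. Comput. Sci.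
  235 (2000) 71–88, §5 (A3).
-/

noncomputable section

open MvPolynomial

namespace Literature.Computability.AlgebraicComplexity

open ArithCircuit

variable {k : Type*} {σ τ : Type*}

/-! ### Renaming inputs commutes with the skeleton -/

/-- Renaming operands twice. [cite: Burgisser2000TCS, §5 (A3) p. 85] -/
theorem Operand.rename_rename {α β γ : Type*} (f : α → β) (g : β → γ) (u : Operand k α) :
    (u.rename f).rename g = u.rename (g ∘ f) := by
  cases u <;> rfl

/-- Renaming gates twice. [cite: Burgisser2000TCS, §5 (A3) p. 85] -/
theorem Gate.rename_rename {α β γ : Type*} (f : α → β) (g : β → γ) (x : Gate k α) :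
    (x.rename f).rename g = x.rename (g ∘ f) := by
  cases x <;> simp [Gate.rename, List.map_map, Function.comp_def, Operand.rename_rename]

/-- Renaming operands along the identity. [cite: Burgisser2000TCS, §5 (A3) p. 85] -/
theorem Operand.rename_id' {α : Type*} (u : Operand k α) : u.rename id = u := by
  cases u <;> rfl

/-- Renaming gates along the identity. [cite: Burgisser2000TCS, §5 (A3) p. 85] -/
theorem Gate.rename_id' {α : Type*} (x : Gate k α) : x.rename id = x := by
  have h : (Operand.rename id : Operand k α → Operand k α) = id := funext Operand.rename_id'
  cases x <;> simp [Gate.rename, h]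

/-- Skeleton of a renamed operand. [cite: Burgisser2000TCS, §5 (A3) p. 85] -/
theorem skelOperand_rename (M slot : ℕ) (e : σ → τ) (u : Operand k σ) :
    (skelOperand M slot (u.rename e) : Operand ℤ (τ ⊕ Fin (M + 1))) =
      (skelOperand M slot u).rename (Sum.map e id) := by
  cases u <;> rfl

/-- Skeleton triple of a renamed gate. [cite: Burgisser2000TCS, §5 (A3) p. 85] -/
theorem skelTriple_rename (M j : ℕ) (e : σ → τ) (g : Gate k σ) :
    skelTriple M j (g.rename e) = (skelTriple M j g).map (Gate.rename (Sum.map e id)) := by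
  rcases g with (_ | ⟨a, _ | ⟨b, l⟩⟩) | (_ | ⟨u, _ | ⟨v, l⟩⟩) <;>
    simp only [Gate.rename, List.map_cons, List.map_nil, skelTriple, coefGate, skelOperand_rename] <;>
    rfl

/-- Skeleton gate list of a renamed gate list. [cite: Burgisser2000TCS, §5 (A3) p. 85] -/
theorem skelGates_rename (M : ℕ) (e : σ → τ) : ∀ (j : ℕ) (gs : List (Gate k σ)),
    skelGates M j (gs.map (Gate.rename e)) = (skelGates M j gs).map (Gate.rename (Sum.map e id))
  | _, [] => rfl
  | j, g :: gs => by
    rw [List.map_cons, skelGates, skelGates, List.map_append, skelTriple_rename,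
      skelGates_rename M e (j + 1) gs]

/-- Changing the (propositionally equal) slot bound is a renaming along `Fin.cast`. [cite: Burgisser2000TCS, §5 (A3) p. 85] -/
theorem skelOperand_cast {M M' : ℕ} (h : M = M') {slot slot' : ℕ} (hs : slot = slot')
    (u : Operand k σ) :
    (skelOperand M' slot' u : Operand ℤ (σ ⊕ Fin (M' + 1))) =
      (skelOperand M slot u).rename (Sum.map id (Fin.cast (by rw [h]))) := by
  subst h; subst hs
  cases u <;> rfl

/-- Changing the (propositionally equal) slot bound of a skeleton gate list. [cite: Burgisser2000TCS, §5 (A3) p. 85] -/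
theorem skelGates_cast {M M' : ℕ} (h : M = M') (j : ℕ) (gs : List (Gate k σ)) :
    skelGates M' j gs = (skelGates M j gs).map (Gate.rename (Sum.map id (Fin.cast (by rw [h])))) := by
  subst h
  have hid : (Sum.map id (Fin.cast (rfl : M + 1 = M + 1)) : σ ⊕ Fin (M + 1) → σ ⊕ Fin (M + 1)) = id := by
    funext x; cases x <;> rfl
  have h2 : (Gate.rename (id : σ ⊕ Fin (M + 1) → σ ⊕ Fin (M + 1)) :
      Gate ℤ (σ ⊕ Fin (M + 1)) → Gate ℤ (σ ⊕ Fin (M + 1))) = id := funext Gate.rename_id'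
  rw [hid, h2, List.map_id]

/-- **The skeleton commutes with renaming the input variables**: the slot indeterminates are
untouched (up to the cast recording `(P.rename e).size = P.size`). [cite: Burgisser2000TCS, §5 (A3) p. 85] -/
theorem skeleton_rename (P : ArithCircuit k σ) (e : σ → τ) :
    skeleton (P.rename e) =
      (skeleton P).rename (Sum.map e (Fin.cast (by rw [ArithCircuit.size_rename]))) := by
  have hsz : 4 * P.size = 4 * (P.rename e).size := by rw [ArithCircuit.size_rename]
  have hcomp : ((Sum.map e id : σ ⊕ Fin (4 * (P.rename e).size + 1) → τ ⊕ Fin (4 * (P.rename e).size + 1)) ∘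
      (Sum.map id (Fin.cast (by rw [hsz]) : Fin (4 * P.size + 1) → Fin (4 * (P.rename e).size + 1)) :
        σ ⊕ Fin (4 * P.size + 1) → σ ⊕ Fin (4 * (P.rename e).size + 1))) =
      Sum.map e (Fin.cast (by rw [ArithCircuit.size_rename])) := by
    funext x; cases x <;> rfl
  set φ : σ ⊕ Fin (4 * P.size + 1) → τ ⊕ Fin (4 * (P.rename e).size + 1) :=
    Sum.map e (Fin.cast (by rw [ArithCircuit.size_rename])) with hφ
  have hg : (skeleton (P.rename e)).gates = ((skeleton P).rename φ).gates := by
    show skelGates (4 * (P.rename e).size) 0 (P.gates.map (Gate.rename e)) =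
      (skelGates (4 * P.size) 0 P.gates).map (Gate.rename φ)
    rw [skelGates_rename, skelGates_cast hsz, List.map_map]
    refine List.map_congr_left fun g _ => ?_
    rw [Function.comp_apply, Gate.rename_rename, hcomp]
  have ho : (skeleton (P.rename e)).output = ((skeleton P).rename φ).output := by
    show skelOperand (4 * (P.rename e).size) (4 * (P.rename e).size) (P.output.rename e) =
      (skelOperand (4 * P.size) (4 * P.size) P.output).rename φ
    rw [skelOperand_rename, skelOperand_cast hsz hsz, Operand.rename_rename, hcomp]
  calc skeleton (P.rename e)
      = ⟨(skeleton (P.rename e)).gates, (skeleton (P.rename e)).output⟩ := rfl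
    _ = ⟨((skeleton P).rename φ).gates, ((skeleton P).rename φ).output⟩ := by rw [hg, ho]
    _ = (skeleton P).rename φ := rfl

/-- Hence the polynomial computed by the skeleton of `P.rename e` is the renamed polynomial of the
skeleton of `P`. [cite: Burgisser2000TCS, §5 (A3) p. 85] -/
theorem eval_skeleton_rename (P : ArithCircuit k σ) (e : σ → τ) :
    (skeleton (P.rename e)).eval =
      MvPolynomial.rename (Sum.map e (Fin.cast (by rw [ArithCircuit.size_rename]))) (skeleton P).eval := by
  rw [skeleton_rename, ArithCircuit.eval_rename_apply]

/-! ### Naturality of `sumAlgEquiv` under renaming -/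

/-- `sumAlgEquiv` after renaming both summands = rename the outer variables and rename the
coefficient variables. [cite: Burgisser2000TCS, §5 (A3) p. 85] -/
theorem sumAlgEquiv_rename_sumMap {R : Type*} [CommSemiring R] {α α' β β' : Type*}
    (e : α → α') (f : β → β') (F : MvPolynomial (α ⊕ β) R) :
    sumAlgEquiv R α' β' (MvPolynomial.rename (Sum.map e f) F) =
      MvPolynomial.rename e (MvPolynomial.map (MvPolynomial.rename f).toRingHom (sumAlgEquiv R α β F)) := by
  have key : ((sumAlgEquiv R α' β').toAlgHom.toRingHom.comp
      (MvPolynomial.rename (Sum.map e f) : MvPolynomial (α ⊕ β) R →ₐ[R] _).toRingHom) =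
      (MvPolynomial.rename e : MvPolynomial α (MvPolynomial β' R) →ₐ[MvPolynomial β' R] _).toRingHom.comp
        ((MvPolynomial.map (MvPolynomial.rename f).toRingHom).comp
          (sumAlgEquiv R α β).toAlgHom.toRingHom) := by
    refine MvPolynomial.ringHom_ext (fun r => ?_) (fun i => ?_)
    · simp
    · cases i with
      | inl a => simp
      | inr b => simp
  exact congrArg (fun φ : MvPolynomial (α ⊕ β) R →+* MvPolynomial α' (MvPolynomial β' R) => φ F) key

/-- **Coefficient transport**: for `e` injective, the coefficient of `x^{e(α)}` in
`sumAlgEquiv (rename (Sum.map e f) F)` is the `f`-renamed coefficient of `x^α` in `sumAlgEquiv F`.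
[cite: Burgisser2000TCS, §5 (A3) p. 85] -/
theorem coeff_mapDomain_sumAlgEquiv_rename {R : Type*} [CommSemiring R] {α α' β β' : Type*}
    {e : α → α'} (he : Function.Injective e) (f : β → β') (F : MvPolynomial (α ⊕ β) R)
    (d : α →₀ ℕ) :
    coeff (Finsupp.mapDomain e d) (sumAlgEquiv R α' β' (MvPolynomial.rename (Sum.map e f) F)) =
      MvPolynomial.rename f (coeff d (sumAlgEquiv R α β F)) := by
  rw [sumAlgEquiv_rename_sumMap, coeff_rename_mapDomain _ he, coeff_map]
  rfl

end Literature.Computability.AlgebraicComplexity
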